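import Summits.CriticalPhenomena.CardyFormulaZ2.Theorems.CardyFlipRussoCoveringLegUniversality
import HarnessLib

/-!
# PROMOTE-STUB dossier (lead c3, cycle 4): the one open input of crux `CardyFlipRusso.CoveringLeg`
(stmt-CriticalPhenomena-6435), ready to file as ONE shared conjecture-grade item

`SiteBondCrossingUniversality` below is, VERBATIM, the hypothesis of the landed theorem
`coveringLeg_of_siteBondCrossingUniversality` (Theorems/CardyFlipRussoCoveringLegUniversality.lean, p123912):
frame-free crossing universality between critical site percolation on the centred square lattice `G_s`
(rotated by `−45°`, site spacing `δ`) and critical bond percolation on `ℤ²` (edge length `√2·δ`, the tree's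
`squareLatticeEmbedding.z`), both in the crude `2δ`-slack discretisation of the crux.  It mentions only
Literature/Mathlib constants, so a planner can paste the body as the `--signature` of a statement item.

Checked facts (this file elaborates sorry-free against the tree):
* `coveringLeg_of_U`      : U → CoveringLeg                        (the crux BY NAME; all glue landed)
* `U_of_cardy`            : SiteCardy → BondCardy → U              (so U is NECESSARY given both Cardy formulas)
* `coveringLeg_iff_U`     : SiteCardy → (CoveringLeg ↔ U)          (under the crux hypothesis the crux IS U)
Hence: filing U once (shared by CardyFlipRusso.CoveringLeg and, via the anchoring-uniform eq. (5.1)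
`PivotalBalanceUniform` ⊋ U, by CardySectorGap's stmt-7049/7050) makes CoveringLeg landed glue.
-/

noncomputable section

namespace Summit.CriticalPhenomena.CardyFormulaZ2.Cruxes.CoveringLeg.FiveArmNull.Promote

open Filter Set Topology
open Literature.Probability.RandomPlanarGeometry Literature.Probability.Percolation
open Literature.Probability.LatticeModels
open Summit.CriticalPhenomena.CardyFormulaZ2.Cruxes.CoveringLeg.FiveArmNull

/-- **U — site-`G_s`/bond-`ℤ²` crossing universality (crude discretisation, frame-free).**  For every conformal
rectangle `R`: the crude crossing probability of `R` for site percolation at `½` on the `−45°`-rotated centred square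
lattice of site spacing `δ`, minus the crude crossing probability of `R` for bond percolation at `½` on `ℤ²` of edge
length `√2·δ`, tends to `0` as `δ → 0⁺`.  OPEN (the site-`G_s`/bond-`ℤ²` instance of the crossing-universality
hypothesis, Langlands–Pouliot–Saint-Aubin 1994 §2; Beffara 2008 §5 is the only attack in print and stops at eq. (5.1)).
This `def` is the TEXT to file; it asserts nothing. -/
def SiteBondCrossingUniversality : Prop :=
  let z : (ℤ × ℤ) ⊕ (ℤ × ℤ) → ℂ := Sum.elim (fun x ↦ (x.1 : ℂ) + (x.2 : ℂ) * Complex.I)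
      (fun f ↦ ((f.1 : ℂ) + 1 / 2) + ((f.2 : ℂ) + 1 / 2) * Complex.I)
  let G : SimpleGraph ((ℤ × ℤ) ⊕ (ℤ × ℤ)) := SimpleGraph.fromRel (fun a b ↦ a.isLeft = true ∧
      ((b.isLeft = true ∧ dist (z a) (z b) = 1) ∨ (b.isRight = true ∧ dist (z a) (z b) < 1)))
  let zρ : (ℤ × ℤ) ⊕ (ℤ × ℤ) → ℂ := fun y ↦ (1 - Complex.I) / (Real.sqrt 2 : ℂ) * z y
  ∀ R : Literature.Probability.RandomPlanarGeometry.ConformalRectangle, Filter.Tendsto (fun δ : ℝ ↦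
      (Literature.Probability.Percolation.sitePercolation ((ℤ × ℤ) ⊕ (ℤ × ℤ))
          Literature.Probability.Percolation.half).real
        {ω | ∃ u v, Metric.infDist ((δ : ℂ) * zρ u) (R.arc 0) ≤ 2 * δ ∧
          Metric.infDist ((δ : ℂ) * zρ v) (R.arc 2) ≤ 2 * δ ∧
          ω ∈ Literature.Probability.Percolation.siteConnIn G {y | (δ : ℂ) * zρ y ∈ R.carrier} u v} -
      (Literature.Probability.Percolation.bondPercolation (Literature.Probability.LatticeModels.zdGraph 2)
          Literature.Probability.Percolation.half).real
        (Literature.Probability.Percolation.embDomainCrossing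
          Literature.Probability.LatticeModels.squareLatticeEmbedding.z R.carrier δ (R.arc 0) (R.arc 2)))
      (nhdsWithin 0 (Set.Ioi 0)) (nhds 0)

/-- U is literally the frame-`A` universality statement of the line (rigid transport `siteProb_map_rotInv_eq`). -/
theorem U_iff :
    SiteBondCrossingUniversality ↔
      ∀ R : ConformalRectangle, Tendsto (fun δ : ℝ =>
        siteProb (R.map (similarity ((1 + Complex.I) / (Real.sqrt 2 : ℂ)) frame_rotInv_ne_zero 0)) δ -
          bondProb R δ) (𝓝[>] 0) (𝓝 0) := by
  constructor
  · intro hU R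
    simp only [siteProb_map_rotInv_eq]
    exact hU R
  · intro h R
    have := h R
    simp only [siteProb_map_rotInv_eq] at this
    exact this

/-- **U ⟹ the crux** (by name; all glue landed, p123912). -/
theorem coveringLeg_of_U (hU : SiteBondCrossingUniversality) :
    Summit.CriticalPhenomena.CardyFormulaZ2.Theses.CardyFlipRusso.CoveringLeg :=
  coveringLeg_of_crossingUniversality (U_iff.1 hU)

/-- **Both Cardy formulas ⟹ U** (unconditional; uniformizing data exist in tree). -/
theorem U_of_cardy (hS : SiteCardy) (hB : BondCardy) : SiteBondCrossingUniversality :=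
  U_iff.2 (siteBondCrossingUniversality_of_cardy hS hB)

/-- **Under the crux hypothesis, the crux IS U.** -/
theorem coveringLeg_iff_U (hS : SiteCardy) :
    Summit.CriticalPhenomena.CardyFormulaZ2.Theses.CardyFlipRusso.CoveringLeg ↔ SiteBondCrossingUniversality :=
  (coveringLeg_iff_universality_of_siteCardy hS).trans U_iff.symm

end Summit.CriticalPhenomena.CardyFormulaZ2.Cruxes.CoveringLeg.FiveArmNull.Promote

end
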